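import Literature.Geometry.Lorentzian.AFEndBreathing
import Literature.Geometry.Manifold.BreathingInverse
import HarnessLib

/-!
# The breathing maps are diffeomorphisms of the `3`-manifold: the inverse `unbreathe`

Sequel to `AFEndBreathing.lean` and `BreathingInverse.lean` (topic `Geometry/Lorentzian`; explicit
construction plus proofs). For breathing data `B : e.BreathingData z₀ r` on the `3`-manifold `X`
and a parameter below the inverse threshold, `|s| < Breathing.invScale z₀ _` (`≤ ¼`), the breathing
map `breathe s = Φₑ ∘ φ_s ∘ coord` (on the coordinate ball, identity elsewhere) is a homeomorphism
of `X` with smooth inverse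

  `unbreathe s = Φₑ ∘ φ_s⁻¹ ∘ coord` on the coordinate ball, identity elsewhere:

* `phi_mem_ball_of_lt_invScale` — below the threshold `φ_s` maps the ball `ball z₀ r` into itself
  (`B ≥ ‖dg(z₀)‖ = 1`, so `|s| < ¼`), hence `breathe s` maps the carrier into itself
  (`breathe_mem_carrier`);
* `unbreathe_breathe`, `breathe_unbreathe` — two-sided inverse; `unbreathe_eq_self_of_not_mem_core`
  — the inverse is the identity off the compact moved set `breatheCore`;
* `contMDiff_unbreathe` — the inverse is smooth; `breatheHomeomorph` — `breathe s` as a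
  homeomorphism of `X` with inverse `unbreathe s`;
* `exists_smooth_inverse_breathe` — the packaged statement used downstream (transport of
  structures living far out, e.g. exact model ends, through the breathing deformation).

## References

* J. M. Lee, *Introduction to Smooth Manifolds*, 2nd ed. (2013), Ch. 9 (compactly supported
  diffeomorphisms), Prop. 2.25. [LeeSmoothManifolds2013]
-/

noncomputable section

open Bundle Set Filter TopologicalSpace Metric Function
open scoped Manifold ContDiff Topology
open Literature.Geometry.Manifold

namespace Literature.Geometry.Lorentzian

namespace AFEnd

variable {X : Type} [TopologicalSpace X] [ChartedSpace E3 X]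
  {e : AFEnd X} {z₀ : E3} {r : ℝ} (B : BreathingData e z₀ r)

/-! ### Below the inverse threshold `φ_s` preserves the ball -/

/-- `‖dg(z₀)‖ = 1 ≤ B`: the derivative bound is at least `1`. [folklore] -/
theorem one_le_derivBound (z₀ : E3) {r : ℝ} (hr : 0 < r) : 1 ≤ Breathing.derivBound z₀ hr := by
  have h := (Breathing.derivBound_spec z₀ hr).2 z₀
  rw [Breathing.fderiv_gField_center z₀ r hr] at h
  rwa [ContinuousLinearMap.norm_id] at h

/-- The inverse threshold is at most `¼`. [folklore] -/
theorem invScale_le_quarter (z₀ : E3) {r : ℝ} (hr : 0 < r) : Breathing.invScale z₀ hr ≤ 1 / 4 := by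
  have h := one_le_derivBound z₀ hr
  unfold Breathing.invScale
  rw [one_div]
  exact inv_anti₀ (by norm_num) (by linarith)

/-- Below the inverse threshold, `|s| < 1`. [folklore] -/
theorem abs_lt_one_of_lt_invScale {z₀ : E3} {r s : ℝ} {hr : 0 < r} (hs : |s| < Breathing.invScale z₀ hr) :
    |s| < 1 := by
  have := invScale_le_quarter z₀ hr
  linarith

/-- **Below the inverse threshold `φ_s` maps the ball `ball z₀ r` into itself**: inside the support
region `‖z − z₀‖² < r²/2` one has `‖φ z − z₀‖ ≤ (1 + |s|) ‖z − z₀‖ < (5/4)(r/√2) < r`, outside it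
`φ z = z`. [cite: LeeSmoothManifolds2013, Ch. 9] -/
theorem phi_mem_ball_of_lt_invScale {z₀ : E3} {r s : ℝ} {hr : 0 < r} (hs : |s| < Breathing.invScale z₀ hr)
    {z : E3} (hz : z ∈ ball z₀ r) : Breathing.phi z₀ r s z ∈ ball z₀ r := by
  by_cases hsupp : r ^ 2 / 2 ≤ ‖z - z₀‖ ^ 2
  · rwa [Breathing.phi_eq_self_of z₀ r hr hsupp s]
  · rw [not_le] at hsupp
    have hs4 : |s| < 1 / 4 := lt_of_lt_of_le hs (invScale_le_quarter z₀ hr)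
    have ha : 0 ≤ ‖z - z₀‖ := norm_nonneg _
    have hsq : (5 / 4 * ‖z - z₀‖) ^ 2 < r ^ 2 := by nlinarith
    have h54 : 5 / 4 * ‖z - z₀‖ < r := lt_of_pow_lt_pow_left₀ 2 hr.le hsq
    have hle : (1 + |s|) * ‖z - z₀‖ ≤ 5 / 4 * ‖z - z₀‖ :=
      mul_le_mul_of_nonneg_right (by linarith [abs_nonneg s]) ha
    have h1 := Breathing.norm_phi_sub_center_le z₀ r s z
    rw [mem_ball, dist_eq_norm]
    linarith

include B in
/-- **Below the inverse threshold, `breathe s` maps the carrier into itself.** [folklore] -/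
theorem breathe_mem_carrier {s : ℝ} (hs : |s| < Breathing.invScale z₀ B.r_pos) {x : X}
    (hx : x ∈ e.breatheCarrier z₀ r) : e.breathe z₀ r s x ∈ e.breatheCarrier z₀ r := by
  obtain ⟨hU, hcoord⟩ := breathe_mem_and_coord B (abs_lt_one_of_lt_invScale hs) hx
  exact ⟨hU, by rw [hcoord]; exact phi_mem_ball_of_lt_invScale hs hx.2⟩

/-! ### The inverse map -/

open scoped Classical in
/-- **The inverse breathing map** `unbreathe s : X → X`: `Φₑ ∘ φ_s⁻¹ ∘ coord` on the coordinate
ball, the identity elsewhere (`|s|` below the inverse threshold). [cite: LeeSmoothManifolds2013, Ch. 9] -/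
def unbreathe (e : AFEnd X) (z₀ : E3) (r s : ℝ) (hr : 0 < r) (hs : |s| < Breathing.invScale z₀ hr) (x : X) : X :=
  if x ∈ e.breatheCarrier z₀ r then e.dataChartExt ((Breathing.phiHomeomorph hs).symm (e.coord x)) else x

variable {s : ℝ} {hr : 0 < r} (hs : |s| < Breathing.invScale z₀ hr)

/-- On the carrier, `unbreathe s x = Φₑ (φ_s⁻¹ (coord x))`. [folklore] -/
theorem unbreathe_of_mem {x : X} (hx : x ∈ e.breatheCarrier z₀ r) :
    e.unbreathe z₀ r s hr hs x = e.dataChartExt ((Breathing.phiHomeomorph hs).symm (e.coord x)) := by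
  classical
  exact if_pos hx

/-- Off the carrier, `unbreathe s x = x`. [folklore] -/
theorem unbreathe_of_not_mem {x : X} (hx : x ∉ e.breatheCarrier z₀ r) : e.unbreathe z₀ r s hr hs x = x := by
  classical
  exact if_neg hx

include B in
/-- On the carrier: `unbreathe s x ∈ U`, `coord (unbreathe s x) = φ_s⁻¹ (coord x)`, and
`unbreathe s x` lies on the carrier again. [folklore] -/
theorem unbreathe_mem_and_coord {x : X} (hx : x ∈ e.breatheCarrier z₀ r) :
    e.unbreathe z₀ r s hr hs x ∈ e.U ∧
      e.coord (e.unbreathe z₀ r s hr hs x) = (Breathing.phiHomeomorph hs).symm (e.coord x) ∧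
      e.unbreathe z₀ r s hr hs x ∈ e.breatheCarrier z₀ r := by
  have hball : (Breathing.phiHomeomorph hs).symm (e.coord x) ∈ ball z₀ r :=
    Breathing.phiHomeomorph_symm_mem_ball hs hx.2
  have hR : e.R < ‖(Breathing.phiHomeomorph hs).symm (e.coord x)‖ :=
    B.R_lt_norm_of_mem_ball (ball_subset_ball (by linarith [B.r_pos]) hball)
  rw [e.unbreathe_of_mem hs hx, e.dataChartExt_of_lt hR]
  have hU : e.dataChart ⟨_, hR⟩ ∈ e.U := (e.chart.symm ⟨_, hR⟩).2
  have hc : e.coord (e.dataChart ⟨_, hR⟩) = (Breathing.phiHomeomorph hs).symm (e.coord x) := e.coord_dataChart _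
  exact ⟨hU, hc, hU, by rw [hc]; exact hball⟩

include B in
/-- **`unbreathe s` is a left inverse of `breathe s`.** [cite: LeeSmoothManifolds2013, Ch. 9] -/
theorem unbreathe_breathe (x : X) :
    e.unbreathe z₀ r s hr hs (e.breathe z₀ r s x) = x := by
  by_cases hx : x ∈ e.breatheCarrier z₀ r
  · have hmem : e.breathe z₀ r s x ∈ e.breatheCarrier z₀ r := breathe_mem_carrier B hs hx
    obtain ⟨-, hcoord⟩ := breathe_mem_and_coord B (abs_lt_one_of_lt_invScale hs) hx
    rw [e.unbreathe_of_mem hs hmem, hcoord, Breathing.phiHomeomorph_symm_phi hs,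
      e.dataChartExt_of_lt (e.lt_norm_coord hx.1), e.dataChart_coord hx.1]
  · rw [e.breathe_of_not_mem hx, e.unbreathe_of_not_mem hs hx]

include B in
/-- **`unbreathe s` is a right inverse of `breathe s`.** [cite: LeeSmoothManifolds2013, Ch. 9] -/
theorem breathe_unbreathe (x : X) :
    e.breathe z₀ r s (e.unbreathe z₀ r s hr hs x) = x := by
  by_cases hx : x ∈ e.breatheCarrier z₀ r
  · obtain ⟨-, hcoord, hmem⟩ := unbreathe_mem_and_coord B hs hx
    rw [e.breathe_of_mem hmem, hcoord, Breathing.phi_phiHomeomorph_symm hs,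
      e.dataChartExt_of_lt (e.lt_norm_coord hx.1), e.dataChart_coord hx.1]
  · rw [e.unbreathe_of_not_mem hs hx, e.breathe_of_not_mem hx]

/-- **Off the moved set `breatheCore`, `unbreathe s` is the identity**: there `coord x` lies outside
the support region of `g`, where `φ_s⁻¹ = id`. [folklore] -/
theorem unbreathe_eq_self_of_not_mem_core {x : X} (hx : x ∉ breatheCore e z₀ r) :
    e.unbreathe z₀ r s hr hs x = x := by
  by_cases hxc : x ∈ e.breatheCarrier z₀ r
  · -- `coord x ∉ closedBall z₀ (3r/4)`, hence `r²/2 ≤ ‖coord x − z₀‖²`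
    have hnot : e.coord x ∉ closedBall z₀ (3 * r / 4) := by
      intro h
      apply hx
      refine ⟨e.coord x, h, ?_⟩
      rw [e.dataChartExt_of_lt (e.lt_norm_coord hxc.1), e.dataChart_coord hxc.1]
    rw [mem_closedBall, dist_eq_norm, not_le] at hnot
    have hsupp : r ^ 2 / 2 ≤ ‖e.coord x - z₀‖ ^ 2 := by nlinarith
    rw [e.unbreathe_of_mem hs hxc, Breathing.phiHomeomorph_symm_eq_self_of hs hsupp,
      e.dataChartExt_of_lt (e.lt_norm_coord hxc.1), e.dataChart_coord hxc.1]
  · exact e.unbreathe_of_not_mem hs hxc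

/-! ### Smoothness of the inverse -/

include B in
/-- The chart formula `x ↦ Φₑ (φ_s⁻¹ (coord x))` is smooth at points of the carrier. [folklore] -/
theorem contMDiffAt_unbreathe_formula {x : X} (hx : x ∈ e.breatheCarrier z₀ r) :
    ContMDiffAt (𝓡 3) (𝓡 3) ∞
      (fun y : X ↦ e.dataChartExt ((Breathing.phiHomeomorph hs).symm (e.coord y))) x := by
  have hball : (Breathing.phiHomeomorph hs).symm (e.coord x) ∈ ball z₀ r :=
    Breathing.phiHomeomorph_symm_mem_ball hs hx.2
  have hR : e.R < ‖(Breathing.phiHomeomorph hs).symm (e.coord x)‖ :=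
    B.R_lt_norm_of_mem_ball (ball_subset_ball (by linarith [B.r_pos]) hball)
  have hcoord : ContMDiffAt (𝓡 3) 𝓘(ℝ, E3) ∞ e.coord x := e.contMDiffAt_coord hx.1
  have hinv : ContMDiffAt (𝓡 3) 𝓘(ℝ, E3) ∞
      (fun y : X ↦ (Breathing.phiHomeomorph hs).symm (e.coord y)) x :=
    (Breathing.contDiff_phiHomeomorph_symm hs (n := ⊤)).contDiffAt.comp_contMDiffAt hcoord
  exact (e.contMDiffAt_dataChartExt hR).comp x hinv

include B in
/-- **`unbreathe s` is smooth** (on the carrier it is the smooth chart formula, off the compact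
moved set it is locally the identity). [cite: LeeSmoothManifolds2013, Ch. 9] -/
theorem contMDiff_unbreathe [T2Space X] : ContMDiff (𝓡 3) (𝓡 3) ∞ (e.unbreathe z₀ r s hr hs) := by
  intro x
  by_cases hx : x ∈ e.breatheCarrier z₀ r
  · refine (contMDiffAt_unbreathe_formula B hs hx).congr_of_eventuallyEq ?_
    filter_upwards [(e.isOpen_breatheCarrier z₀ r).mem_nhds hx] with y hy
    exact e.unbreathe_of_mem hs hy
  · have hK : x ∉ breatheCore e z₀ r := fun h ↦ hx (breatheCore_subset_carrier B h)
    refine contMDiffAt_id.congr_of_eventuallyEq ?_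
    filter_upwards [(isCompact_breatheCore B).isClosed.isOpen_compl.mem_nhds hK] with y hy
    exact unbreathe_eq_self_of_not_mem_core hs hy

/-! ### The breathing homeomorphism -/

/-- **`breathe s` as a homeomorphism of `X`** with inverse `unbreathe s` (`|s|` below the inverse
threshold). [cite: LeeSmoothManifolds2013, Ch. 9] -/
def breatheHomeomorph [T2Space X] (B : BreathingData e z₀ r) {s : ℝ}
    (hs : |s| < Breathing.invScale z₀ B.r_pos) : X ≃ₜ X where
  toFun := e.breathe z₀ r s
  invFun := e.unbreathe z₀ r s B.r_pos hs
  left_inv := unbreathe_breathe B hs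
  right_inv := breathe_unbreathe B hs
  continuous_toFun := (contMDiff_breathe B (abs_lt_one_of_lt_invScale hs)).continuous
  continuous_invFun := (contMDiff_unbreathe B hs).continuous

/-- The homeomorphism is `breathe s` as a function. [folklore] -/
@[simp] theorem coe_breatheHomeomorph [T2Space X] {s : ℝ} (hs : |s| < Breathing.invScale z₀ B.r_pos) :
    ⇑(breatheHomeomorph B hs) = e.breathe z₀ r s := rfl

/-- The inverse of the homeomorphism is `unbreathe s`. [folklore] -/
@[simp] theorem coe_breatheHomeomorph_symm [T2Space X] {s : ℝ} (hs : |s| < Breathing.invScale z₀ B.r_pos) :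
    ⇑(breatheHomeomorph B hs).symm = e.unbreathe z₀ r s B.r_pos hs := rfl

include B in
/-- **The breathing maps are diffeomorphisms** (packaged): for `|s|` below the inverse threshold
there is a smooth two-sided inverse of `breathe s`, equal to the identity off the moved set.
[cite: LeeSmoothManifolds2013, Ch. 9] -/
theorem exists_smooth_inverse_breathe [T2Space X] {s : ℝ} (hs : |s| < Breathing.invScale z₀ B.r_pos) :
    ∃ Ψ : X → X, ContMDiff (𝓡 3) (𝓡 3) ∞ Ψ ∧ (∀ x, Ψ (e.breathe z₀ r s x) = x) ∧
      (∀ x, e.breathe z₀ r s (Ψ x) = x) ∧ ∀ x ∉ breatheCore e z₀ r, Ψ x = x :=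
  ⟨e.unbreathe z₀ r s B.r_pos hs, contMDiff_unbreathe B hs, unbreathe_breathe B hs,
    breathe_unbreathe B hs, fun _ hx ↦ unbreathe_eq_self_of_not_mem_core hs hx⟩

end AFEnd

end Literature.Geometry.Lorentzian

end
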